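import Summits.HodgeConjecture.HodgeConjecture.Theses.AnchorTransport
import Literature.AlgebraicGeometry.HodgeTheory.PadicResidueDiscGenericPoint
import Literature.AlgebraicGeometry.Limits.SmoothAffineIntegralModel
import Literature.AlgebraicGeometry.Motives.SmoothProperWittModelBaseChange
import Literature.AlgebraicGeometry.Crystalline.BlochEsnaultKerzLifting

/-!
# Route AnchorTransport — crux `VariationalHodge` (stmt-HodgeConjecture-1076), line `padic-disc-transport`:
# the ARITHMETIC DISC of STUB S (`ArithmeticDiscSupply`) — two `W(𝔽̄_q)`-models with a common special fibre,
# one of the anchor fibre, one of a `k`-GENERIC fibre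

HONEST FRAMING: research route conditional on HC_CM; not a corollary; Q11.4-sentence-2 already refuted in dim ≥ 3.
Helper file on the crux item (nothing here closes it; no definition, no named fact, no `sorry`;
`HC_CM` does not occur). Cell `pub-hodge-ring2`, binder seat `ring2-b03` (gen 35), BINDER-OWNERS row b03.

STUB S of the registered skeleton `Cruxes/VariationalHodge/Lines/padic_disc_transport.lean` is the
"Maulik–Poonen disc": for descended crux data over a countable field `k ↪ ℂ`, an anchor `s₀` and a
bound `N`, a prime `q ≥ N`, `κ = 𝔽̄_q`, a smooth proper model `𝒴 / W(κ)` of a `k`-GENERIC fibre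
`X_s`, a pro-class `ξ̂` on it and the implication "`ξ̂|_{Y_κ}` algebraizes ⟹ `A|_{X_s}` algebraic". Its
intended witness takes `𝒴` in the `q`-ADIC RESIDUE DISC of the anchor: `𝒴` and the model `𝒴₀` of the
anchor fibre `X_{s₀}` are the fibres of ONE smooth projective `W(κ)`-family over two `W(κ)`-points with
the same reduction, so that they have the SAME SPECIAL FIBRE `Y_κ` (which carries the reduction of the
anchor cycle). Gen 33 of this seat proved the model-supply half for one fibre at a time
(`Theorems.padicModelSupply`); this file proves the DISC form, given a smooth projective model of the
family over a smooth affine model `Spec B → Spec R` of the base curve over a finitely generated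
`ℤ`-algebra `R → ℂ` (the spreading-out datum of Maulik–Poonen 2012, §4):

* `padicBaseDiscSupply` — UNCONDITIONAL on the skeleton's carriers (no model hypothesis): for the
  descended base curve `S` (affine, irreducible, smooth, one-dimensional), every complex point `s₀`
  and every `N`, there are a smooth affine model `Spec B → Spec R` of `S` over a finitely generated
  `ℤ`-algebra `R → ℂ` (`Limits.exists_smooth_affine_model_finiteType_int`), a prime `q ≥ N`,
  `κ = 𝔽̄_q`, `W(κ)`-points `β₀ β : B → W(κ)` of the model over the same point of `Spec R` and with
  the SAME REDUCTION, and `ι : K(q, κ) →+* ℂ` with `ι ∘ β₀ =` the point `s₀` and `ι ∘ β =` a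
  `k`-GENERIC point `s` — the `q`-adic residue disc of the anchor on the base curve;
* `padicDiscSupply` — for every complex point `s₀` of the base and every `N`: a prime `q ≥ N` with
  `n + 6 < q` (the Bloch–Esnault–Kerz bound), `κ = 𝔽̄_q` with all the instances STUB S quantifies
  over, `W(κ)`-schemes `𝒴₀`, `𝒴` with `WittScheme.IsSmoothProperModel n`, both projective over `W(κ)`
  (`Crystalline.IsProjectiveOverRing`, the hypothesis of `Crystalline.BlochEsnaultKerzLifting`),
  `ι : K(q, κ) →+* ℂ` with `𝒴₀,K ⊗_ι ℂ ≅ X_{s₀}` and `𝒴_K ⊗_ι ℂ ≅ X_s` for a `k`-GENERIC complex point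
  `s` (the unfolded `PadicDiscTransport.IsGenericPoint k σ s`), and an isomorphism of `κ`-schemes
  `Y₀,κ ≅ Y_κ` of the special fibres.

The mathematics is Literature: `HodgeTheory.exists_wittVector_points_same_reduction_generic`
(Cassels' embedding, uncountability of `q`-adic residue discs of smooth `W`-curves, countability of
the non-generic complex points of a curve over a countable field — Maulik–Poonen 2012 §4) and
`Motives.isSmoothProperModel_baseChange_wittVector` (the `W`-model along a `W`-point, Zariski
connectedness over `W(κ)`).
-/

noncomputable section

-- every declaration of this problem lives in `Summit.HodgeConjecture.HodgeConjecture.…` (summit = sub-problem)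
set_option linter.dupNamespace false

open CategoryTheory CategoryTheory.Limits AlgebraicGeometry
open Literature.AlgebraicGeometry.Motives Literature.AlgebraicGeometry.HodgeTheory
open scoped Isocrystal

namespace Summit.HodgeConjecture.HodgeConjecture.Theorems

/-- **The fibre of the complex family over a complex point is the fibre of the model over the
corresponding ring map.** If the complex family `f : 𝒳 ⟶ S` is the base change of `g : Y → Spec B`
along `π : S → Spec B` and the complex point `t` of `S` is the ring map `χ : B → ℂ` (`t ≫ π = Spec χ`),
then `X_t → Spec ℂ` is the base change of `g` along `Spec χ`. -/
theorem isPullback_fiberOver_of_model {𝒳 S : SchemeOver ℂ} (f : 𝒳 ⟶ S) {B : Type} [CommRing B]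
    {Y : Scheme.{0}} (g : Y ⟶ Spec (.of B)) (πS : S.left ⟶ Spec (.of B)) (π𝒳 : 𝒳.left ⟶ Y)
    (h𝒳 : IsPullback π𝒳 f.left g πS) (t : ComplexPoints S) (χ : B →+* ℂ)
    (ht : t.left ≫ πS = Spec.map (CommRingCat.ofHom χ)) :
    IsPullback (pullback.fst f.left t.left ≫ π𝒳) (fiberOver f t).hom g
      (Spec.map (CommRingCat.ofHom χ)) := by
  have h1 : (fiberOver f t).hom = pullback.snd f.left t.left := by
    rw [fiberOver_hom]
    have h2 : (specOver ℂ ℂ).hom = 𝟙 (Spec (.of ℂ)) := by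
      change Spec.map (CommRingCat.ofHom (algebraMap ℂ ℂ)) = _
      rw [Algebra.algebraMap_self, CommRingCat.ofHom_id, Spec.map_id]
    rw [h2]
    exact Category.comp_id _
  rw [h1, ← ht]
  exact (IsPullback.of_hasPullback f.left t.left).paste_horiz h𝒳

/-- **THE ARITHMETIC DISC for STUB S (`ArithmeticDiscSupply`) of line `padic-disc-transport`**
(Maulik–Poonen 2012, §4, on the tree's carriers). Data: the crux data descended to a countable field
`k` along `σ : k →+* ℂ` — a smooth projective family `(baseChangeHom σ).map f₀` of relative dimension
`n` over the complexification `S` of `S₀`, `S` affine, irreducible, smooth, one-dimensional — together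
with a SPREADING-OUT DATUM: a finitely generated `ℤ`-algebra `R → ℂ`, a smooth affine `R`-curve
`Spec B → Spec R` whose base change along `R → ℂ` is `S` (`π : S → Spec B` cartesian), and a closed
subscheme `Y ↪ ℙᴹ_B`, proper and smooth of relative dimension `n` over `B`, whose base change along
`π` is the family. Conclusion: for every complex point `s₀` of `S` and every `N` there are a prime
`q ≥ N` with `n + 6 < q`, `κ = 𝔽̄_q` (algebraically closed, perfect, algebraic over `ZMod q`), smooth
proper `W(κ)`-models `𝒴₀`, `𝒴` of relative dimension `n` (`WittScheme.IsSmoothProperModel`), both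
projective over `W(κ)` (`Crystalline.IsProjectiveOverRing`), an embedding `ι : K(q, κ) →+* ℂ` with
`𝒴₀,K ⊗_ι ℂ ≅ X_{s₀}` and `𝒴_K ⊗_ι ℂ ≅ X_s` for a complex point `s` which is `k`-GENERIC
(`PadicDiscTransport.IsGenericPoint k σ s`, unfolded), and an isomorphism of the special fibres
`Y₀,κ ≅ Y_κ` over `κ` — `𝒴₀` and `𝒴` are the fibres of the `W(κ)`-family `Y ⊗_R W(κ)` over two
`W(κ)`-points of the smooth `W(κ)`-curve `Spec (B ⊗_R W(κ))` with the same reduction. -/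
theorem padicDiscSupply (N : ℕ) (k : Type) [Field k] [Countable k] (σ : k →+* ℂ) {n : ℕ}
    {𝒳₀ S₀ : SchemeOver k} (f₀ : 𝒳₀ ⟶ S₀)
    (hf : IsSmoothProjectiveFamily ((baseChangeHom σ).map f₀) n)
    [IrreducibleSpace ((baseChangeHom σ).obj S₀).left] [IsAffine ((baseChangeHom σ).obj S₀).left]
    (hsm : AlgebraicGeometry.Smooth ((baseChangeHom σ).obj S₀).hom)
    (hdim : topologicalKrullDim ((baseChangeHom σ).obj S₀).left = 1)
    {R B : Type} [CommRing R] [CommRing B] [Algebra R B] [Algebra.FiniteType ℤ R]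
    [Algebra.FiniteType R B]
    [SmoothOfRelativeDimension 1 (Spec.map (CommRingCat.ofHom (algebraMap R B)))]
    (τ : R →+* ℂ) (πS : ((baseChangeHom σ).obj S₀).left ⟶ Spec (.of B))
    (hπS : IsPullback πS ((baseChangeHom σ).obj S₀).hom
      (Spec.map (CommRingCat.ofHom (algebraMap R B))) (Spec.map (CommRingCat.ofHom τ)))
    {M : ℕ} {Y : Scheme.{0}} (g : Y ⟶ Spec (.of B))
    (emb : letI := MvPolynomial.gradedAlgebra (σ := Fin (M + 1)) (R := B)
      Y ⟶ Proj (MvPolynomial.homogeneousSubmodule (Fin (M + 1)) B))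
    (hemb : IsClosedImmersion emb)
    (hembg : letI := MvPolynomial.gradedAlgebra (σ := Fin (M + 1)) (R := B)
      emb ≫ ProjBaseChangeRing.projToSpec (Fin (M + 1)) B = g)
    (hgP : IsProper g) (hgS : SmoothOfRelativeDimension n g)
    (π𝒳 : ((baseChangeHom σ).obj 𝒳₀).left ⟶ Y)
    (h𝒳 : IsPullback π𝒳 ((baseChangeHom σ).map f₀).left g πS)
    (s₀ : ComplexPoints ((baseChangeHom σ).obj S₀)) :
    ∃ (q : ℕ) (_ : Fact q.Prime) (κ : Type) (_ : Field κ) (_ : CharP κ q) (_ : PerfectRing κ q)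
      (_ : IsAlgClosed κ) (_ : Algebra (ZMod q) κ) (_ : Algebra.IsAlgebraic (ZMod q) κ)
      (𝒴₀ 𝒴 : SchemeOver (WittVector q κ)) (ι : K(q, κ) →+* ℂ)
      (s : ComplexPoints ((baseChangeHom σ).obj S₀)),
      N ≤ q ∧ n + 6 < q ∧
      WittScheme.IsSmoothProperModel n 𝒴₀ ∧ WittScheme.IsSmoothProperModel n 𝒴 ∧
      Literature.AlgebraicGeometry.Crystalline.IsProjectiveOverRing 𝒴₀ ∧
      Literature.AlgebraicGeometry.Crystalline.IsProjectiveOverRing 𝒴 ∧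
      Nonempty ((baseChangeHom ι).obj (WittScheme.genericFibre 𝒴₀) ≅
        fiberOver ((baseChangeHom σ).map f₀) s₀) ∧
      Nonempty ((baseChangeHom ι).obj (WittScheme.genericFibre 𝒴) ≅
        fiberOver ((baseChangeHom σ).map f₀) s) ∧
      Nonempty (WittScheme.specialFibre 𝒴₀ ≅ WittScheme.specialFibre 𝒴) ∧
      (∀ Z : Set (ComplexPoints ((baseChangeHom σ).obj S₀)),
        IsDefinedOver σ S₀ σ.fieldRange Z → s ∈ Z → Z = Set.univ) := by
  classical
  haveI : LocallyOfFiniteType ((baseChangeHom σ).obj S₀).hom := by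
    haveI : Smooth ((baseChangeHom σ).obj S₀).hom := hsm
    infer_instance
  -- 1. the disc: `q`, `κ`, `β₀`, `β`, `ι`, the generic point `s`
  obtain ⟨q, hq, κ, _, _, _, _, _, _, β₀, β, ι, s, hNq, -, hred, -, hs₀, hs, hgen⟩ :=
    exists_wittVector_points_same_reduction_generic σ S₀ τ πS hπS (le_of_eq hdim) s₀
      (max N (n + 7))
  haveI := hq
  -- 2. the two models `Y ⊗_{β₀} W`, `Y ⊗_β W`
  have HX₀ := isPullback_fiberOver_of_model ((baseChangeHom σ).map f₀) g πS π𝒳 h𝒳 s₀ _ hs₀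
  have HX := isPullback_fiberOver_of_model ((baseChangeHom σ).map f₀) g πS π𝒳 h𝒳 s _ hs
  letI := MvPolynomial.gradedAlgebra (σ := Fin (M + 1)) (R := B)
  obtain ⟨emb₀, hemb₀, hemb₀g, h𝒴₀, hiso₀⟩ := isSmoothProperModel_baseChange_wittVector emb hemb
    hembg hgP hgS β₀ ι (hf.isSmoothProjective s₀) _ HX₀
  obtain ⟨emb₁, hemb₁, hemb₁g, h𝒴, hiso⟩ := isSmoothProperModel_baseChange_wittVector emb hemb
    hembg hgP hgS β ι (hf.isSmoothProjective s) _ HX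
  letI := MvPolynomial.gradedAlgebra (σ := Fin (M + 1)) (R := WittVector q κ)
  have hproj₀ : Literature.AlgebraicGeometry.Crystalline.IsProjectiveOverRing
      (Over.mk (pullback.snd g (Spec.map (CommRingCat.ofHom β₀))) : SchemeOver (WittVector q κ)) :=
    ⟨M, Over.homMk emb₀ hemb₀g, hemb₀⟩
  have hproj : Literature.AlgebraicGeometry.Crystalline.IsProjectiveOverRing
      (Over.mk (pullback.snd g (Spec.map (CommRingCat.ofHom β))) : SchemeOver (WittVector q κ)) :=
    ⟨M, Over.homMk emb₁ hemb₁g, hemb₁⟩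
  -- 3. the common special fibre: both are `Y ⊗_{B, β̄} κ`, `β̄₀ = β̄`
  have sq₀ : IsPullback
      (pullback.fst (pullback.snd g (Spec.map (CommRingCat.ofHom β₀)))
          (Spec.map (CommRingCat.ofHom (WittVector.constantCoeff : WittVector q κ →+* κ))) ≫
        pullback.fst g (Spec.map (CommRingCat.ofHom β₀)))
      (WittScheme.specialFibre
        (Over.mk (pullback.snd g (Spec.map (CommRingCat.ofHom β₀))) : SchemeOver (WittVector q κ))).hom
      g (Spec.map (CommRingCat.ofHom ((WittVector.constantCoeff : WittVector q κ →+* κ).comp β₀))) := by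
    rw [CommRingCat.ofHom_comp, Spec.map_comp]
    exact (IsPullback.of_hasPullback (pullback.snd g (Spec.map (CommRingCat.ofHom β₀)))
      (Spec.map (CommRingCat.ofHom (WittVector.constantCoeff : WittVector q κ →+* κ)))).paste_horiz
      (IsPullback.of_hasPullback g (Spec.map (CommRingCat.ofHom β₀)))
  have sq₁ : IsPullback
      (pullback.fst (pullback.snd g (Spec.map (CommRingCat.ofHom β)))
          (Spec.map (CommRingCat.ofHom (WittVector.constantCoeff : WittVector q κ →+* κ))) ≫
        pullback.fst g (Spec.map (CommRingCat.ofHom β)))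
      (WittScheme.specialFibre
        (Over.mk (pullback.snd g (Spec.map (CommRingCat.ofHom β))) : SchemeOver (WittVector q κ))).hom
      g (Spec.map (CommRingCat.ofHom ((WittVector.constantCoeff : WittVector q κ →+* κ).comp β₀))) := by
    rw [hred, CommRingCat.ofHom_comp, Spec.map_comp]
    exact (IsPullback.of_hasPullback (pullback.snd g (Spec.map (CommRingCat.ofHom β)))
      (Spec.map (CommRingCat.ofHom (WittVector.constantCoeff : WittVector q κ →+* κ)))).paste_horiz
      (IsPullback.of_hasPullback g (Spec.map (CommRingCat.ofHom β)))
  have esp : WittScheme.specialFibre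
        (Over.mk (pullback.snd g (Spec.map (CommRingCat.ofHom β₀))) : SchemeOver (WittVector q κ)) ≅
      WittScheme.specialFibre
        (Over.mk (pullback.snd g (Spec.map (CommRingCat.ofHom β))) : SchemeOver (WittVector q κ)) :=
    Over.isoMk (sq₀.isoIsPullback _ _ sq₁) (sq₀.isoIsPullback_hom_snd _ _ sq₁)
  -- 4. assemble
  exact ⟨q, hq, κ, inferInstance, inferInstance, inferInstance, inferInstance, inferInstance,
    inferInstance, Over.mk (pullback.snd g (Spec.map (CommRingCat.ofHom β₀))),
    Over.mk (pullback.snd g (Spec.map (CommRingCat.ofHom β))), ι, s, (le_max_left _ _).trans hNq,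
    by have := (le_max_right N (n + 7)).trans hNq; omega, h𝒴₀, h𝒴, hproj₀, hproj, hiso₀, hiso,
    ⟨esp⟩, hgen⟩


/-- **THE ARITHMETIC DISC ON THE BASE CURVE — unconditional on the skeleton's carriers.** For the
crux data descended to a countable field `k` along `σ : k →+* ℂ` with base `S = S₀ ⊗_σ ℂ` affine,
irreducible, smooth and one-dimensional, every complex point `s₀` of `S` and every bound `N`, there
are: a finitely generated `ℤ`-algebra `R → ℂ` and a smooth affine `R`-curve `Spec B → Spec R`
(relative dimension `1`, `B` of finite type) with a cartesian square `π : S → Spec B` over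
`Spec ℂ → Spec R` (spreading out, `Limits.exists_smooth_affine_model_finiteType_int`); a prime
`q ≥ N`; `κ = 𝔽̄_q` with all the instances STUB S quantifies over; ring maps `β₀ β : B → W(κ)`
agreeing on `R`, with the SAME REDUCTION `B → κ`; an embedding `ι : K(q, κ) →+* ℂ` with
`ι ∘ β₀ ∘ (R → B) = (R → ℂ)`; such that `ι ∘ β₀` is the point `s₀`, `ι ∘ β` is a point `s`, and `s`
is `k`-GENERIC (`PadicDiscTransport.IsGenericPoint k σ s`, unfolded) — Maulik–Poonen 2012, §4:
`β` lies in the `q`-adic residue disc of the anchor `β₀` on the smooth `W(κ)`-curve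
`Spec (B ⊗_R W(κ))` (`HodgeTheory.exists_wittVector_points_same_reduction_generic`). -/
theorem padicBaseDiscSupply (N : ℕ) (k : Type) [Field k] [Countable k] (σ : k →+* ℂ)
    (S₀ : SchemeOver k)
    [IrreducibleSpace ((baseChangeHom σ).obj S₀).left] [IsAffine ((baseChangeHom σ).obj S₀).left]
    (hsm : AlgebraicGeometry.Smooth ((baseChangeHom σ).obj S₀).hom)
    (hdim : topologicalKrullDim ((baseChangeHom σ).obj S₀).left = 1)
    (s₀ : ComplexPoints ((baseChangeHom σ).obj S₀)) :
    ∃ (R B : Type) (_ : CommRing R) (_ : CommRing B) (_ : Algebra R B) (_ : Algebra R ℂ)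
      (_ : Algebra.FiniteType ℤ R) (_ : Algebra.FiniteType R B)
      (_ : SmoothOfRelativeDimension 1 (Spec.map (CommRingCat.ofHom (algebraMap R B))))
      (πS : ((baseChangeHom σ).obj S₀).left ⟶ Spec (.of B))
      (_ : IsPullback πS ((baseChangeHom σ).obj S₀).hom
        (Spec.map (CommRingCat.ofHom (algebraMap R B))) (Spec.map (CommRingCat.ofHom (algebraMap R ℂ))))
      (q : ℕ) (_ : Fact q.Prime) (κ : Type) (_ : Field κ) (_ : CharP κ q) (_ : PerfectRing κ q)
      (_ : IsAlgClosed κ) (_ : Algebra (ZMod q) κ) (_ : Algebra.IsAlgebraic (ZMod q) κ)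
      (β₀ β : B →+* WittVector q κ) (ι : K(q, κ) →+* ℂ)
      (s : ComplexPoints ((baseChangeHom σ).obj S₀)),
      N ≤ q ∧
      β₀.comp (algebraMap R B) = β.comp (algebraMap R B) ∧
      (WittVector.constantCoeff : WittVector q κ →+* κ).comp β₀ =
        (WittVector.constantCoeff : WittVector q κ →+* κ).comp β ∧
      ((ι.comp (algebraMap (WittVector q κ) K(q, κ))).comp β₀).comp (algebraMap R B) =
        algebraMap R ℂ ∧
      s₀.left ≫ πS =
        Spec.map (CommRingCat.ofHom ((ι.comp (algebraMap (WittVector q κ) K(q, κ))).comp β₀)) ∧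
      s.left ≫ πS =
        Spec.map (CommRingCat.ofHom ((ι.comp (algebraMap (WittVector q κ) K(q, κ))).comp β)) ∧
      (∀ Z : Set (ComplexPoints ((baseChangeHom σ).obj S₀)),
        IsDefinedOver σ S₀ σ.fieldRange Z → s ∈ Z → Z = Set.univ) := by
  classical
  haveI : Smooth ((baseChangeHom σ).obj S₀).hom := hsm
  -- the base is an integral affine curve, smooth of relative dimension `1`
  obtain ⟨d, hd⟩ := exists_smoothOfRelativeDimension_of_smooth ((baseChangeHom σ).obj S₀).hom
  haveI := hd
  haveI : IsReduced ((baseChangeHom σ).obj S₀).left :=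
    isReduced_of_smoothOfRelativeDimension ((baseChangeHom σ).obj S₀).hom d
  haveI : IsIntegral ((baseChangeHom σ).obj S₀).left :=
    isIntegral_of_irreducibleSpace_of_isReduced _
  have hd1 : d = 1 := by
    have h := topologicalKrullDim_eq_of_smoothOfRelativeDimension ((baseChangeHom σ).obj S₀).hom d
    rw [hdim] at h
    exact_mod_cast h.symm
  subst hd1
  -- spreading out the base curve
  obtain ⟨R, _, _, hRft, B, _, _, hBft, πS, hsmB, sq⟩ :=
    Literature.AlgebraicGeometry.Limits.exists_smooth_affine_model_finiteType_int (d := 1)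
      ((baseChangeHom σ).obj S₀)
  haveI := hRft
  haveI := hBft
  haveI := hsmB
  -- the disc
  obtain ⟨q, hq, κ, _, _, _, _, _, _, β₀, β, ι, s, hNq, hR, hred, hτ, hs₀, hs, hgen⟩ :=
    exists_wittVector_points_same_reduction_generic σ S₀ (algebraMap R ℂ) πS sq (le_of_eq hdim) s₀ N
  exact ⟨R, B, inferInstance, inferInstance, inferInstance, inferInstance, hRft, hBft, hsmB, πS, sq,
    q, hq, κ, inferInstance, inferInstance, inferInstance, inferInstance, inferInstance, inferInstance,
    β₀, β, ι, s, hNq, hR, hred, hτ, hs₀, hs, hgen⟩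

end Summit.HodgeConjecture.HodgeConjecture.Theorems

end
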